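import Mathlib.Data.Fin.Tuple.Sort
import Mathlib.Order.Interval.Finset.Fin
import Literature.Combinatorics.SimpleGraph.ColourRefinementOrder
import Literature.Computability.Complexity.GraphRelabelBricks
import HarnessLib

/-!
# Sort-permutation bricks: from a discrete colouring to the code of its sorting permutation, in `FP`

Toolkit (brick algebra), for the discharge programme of `babaiLuks1983_canonicalForm`: the leaf
labelings of an individualization–refinement search tree are the sorting permutations
`Tuple.sort ρ` of the discrete colourings `ρ` at the leaves (`IRScheme.leafLabelings`,
`IndividualizationRefinement.lean`), and the machine lists them as permutation codes
`permCode (Tuple.sort ρ) = encList [1^{e 0}, …, 1^{e (k-1)}]` (`GraphRelabelBricks.lean`). This file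
computes that code from the colouring:

* math: for an injective `ρ : Fin k → ℕ`, the vertex at sorted position `i` is the unique vertex
  of competition rank `i` — `rankOf_sort : rankOf ρ (Tuple.sort ρ i) = i` (`rankOf` of
  `Combinatorics/SimpleGraph/ColourRefinementOrder.lean`: the number of `w` with `ρ w < ρ v`);
* bricks on `z = ⟨1ᵏ, C⟩`, `C = encList [⟨ρ 0⟩₂, …, ⟨ρ (k-1)⟩₂]`: `rankUF` (the rank of `v` in unary,
  a concatenation fold of the value tests `ltFn`), `selectF` (the vertex of rank `i`, in unary), and
  **`sortPermFn ∈ FP`** with **`sortPermFn ⟨1ᵏ, colourListCode ρ⟩ = permCode (Tuple.sort ρ)`** for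
  injective `ρ` (`sortPermFn_apply`).

## References

* S. Arora, B. Barak, *Computational Complexity: A Modern Approach*, CUP 2009, §1.3 (bounded loops).
* B. D. McKay, A. Piperno, *Practical graph isomorphism, II*, J. Symbolic Comput. 60 (2014), §2.2
  ("a discrete colouring is a permutation"). [MckayPiperno2014]
-/

namespace Literature.Computability.Complexity

open _root_.Computability Polynomial Brick Plumb HashBricks GraphRelabel Literature.Combinatorics.SimpleGraph

namespace SortPerm

variable {k : ℕ}

/-! ### Ranks and the sorting permutation -/

/-- **The vertex at sorted position `i` has rank `i`** (for an injective tuple): the `w` with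
`ρ w < ρ (sort ρ i)` are exactly the `sort ρ j`, `j < i`. [cite: MckayPiperno2014, §2.2] -/
theorem rankOf_sort {ρ : Fin k → ℕ} (hρ : Function.Injective ρ) (i : Fin k) :
    rankOf ρ (Tuple.sort ρ i) = i := by
  have hmono : StrictMono (ρ ∘ Tuple.sort ρ) :=
    (Tuple.monotone_sort ρ).strictMono_of_injective (hρ.comp (Tuple.sort ρ).injective)
  unfold rankOf
  rw [← Fin.card_Iio i]
  symm
  refine Finset.card_equiv (Tuple.sort ρ) fun j => ?_
  simp only [Finset.mem_Iio, Finset.mem_filter, Finset.mem_univ, true_and]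
  exact hmono.lt_iff_lt.symm

/-- Hence the vertex of rank `i` is `sort ρ i`. [folklore] -/
theorem eq_sort_of_rankOf_eq {ρ : Fin k → ℕ} (hρ : Function.Injective ρ) {v : Fin k} {i : Fin k}
    (h : rankOf ρ v = i) : v = Tuple.sort ρ i :=
  rankOf_injective ρ hρ (h.trans (rankOf_sort hρ i).symm)

/-! ### Codes -/

/-- The colour-list code `encList [⟨ρ 0⟩₂, …, ⟨ρ (k-1)⟩₂]`. [folklore] -/
def colourListCode (ρ : Fin k → ℕ) : List Bool := encList (List.ofFn fun v : Fin k => encodeNat (ρ v))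

/-- Items of the colour-list code. [folklore] -/
theorem getD_colourList (ρ : Fin k → ℕ) {v : ℕ} (hv : v < k) :
    (List.ofFn fun v : Fin k => encodeNat (ρ v)).getD v [] = encodeNat (ρ ⟨v, hv⟩) := by
  rw [List.getD_eq_getElem?_getD, List.getElem?_ofFn]
  simp [hv]

/-- Concatenated indicator pieces are a unary count. [folklore] -/
theorem ccat_indicator (P : ℕ → Prop) [DecidablePred P] :
    ∀ n : ℕ, ccat (fun w => if P w then [true] else []) n = ones ((Finset.range n).filter P).card
  | 0 => rfl
  | n + 1 => by
    rw [ccat_succ, ccat_indicator P n, Finset.range_add_one, Finset.filter_insert]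
    by_cases h : P n
    · rw [if_pos h, if_pos h, Finset.card_insert_of_notMem (by simp)]
      simp [ones, List.replicate_succ']
    · rw [if_neg h, if_neg h, List.append_nil]

/-- The competition rank over `Fin k`, counted over `range k`. [folklore] -/
theorem card_filter_range_eq_rankOf (ρ : Fin k → ℕ) (v : Fin k) :
    ((Finset.range k).filter fun w => ∃ h : w < k, ρ ⟨w, h⟩ < ρ v).card = rankOf ρ v := by
  unfold rankOf
  rw [← Finset.card_image_of_injective (Finset.univ.filter fun w : Fin k => ρ w < ρ v) Fin.val_injective]
  congr 1
  ext w
  simp only [Finset.mem_filter, Finset.mem_range, Finset.mem_image, Finset.mem_univ, true_and]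
  constructor
  · rintro ⟨-, hw, h⟩
    exact ⟨⟨w, hw⟩, h, rfl⟩
  · rintro ⟨u, hu, rfl⟩
    exact ⟨u.is_lt, u.is_lt, by simpa using hu⟩

/-! ### The rank brick: records `x = ⟨⟨z, 1ⁱ⟩, 1ᵛ⟩`, `z = ⟨1ᵏ, C⟩`, pieces on `⟨x, 1ʷ⟩` -/

/-- The colour list `C` of an inner-piece record `⟨⟨⟨z, 1ⁱ⟩, 1ᵛ⟩, 1ʷ⟩`. [folklore] -/
noncomputable def cF : List Bool → List Bool := sndF ∘ fstF ∘ fstF ∘ fstF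

/-- `cF ∈ FP`. [folklore] -/
theorem cF_mem_FP : cF ∈ FP :=
  comp_mem_FP sndF_mem_FP (comp_mem_FP fstF_mem_FP (comp_mem_FP fstF_mem_FP fstF_mem_FP))

/-- **The inner piece**: `[1]` if `ρ w < ρ v`, else `ε`. [folklore] -/
noncomputable def innerPiece : List Bool → List Bool :=
  iteFn (ltFn ∘ fanoutFn (nthItemFn ∘ fanoutFn sndF cF) (nthItemFn ∘ fanoutFn (sndF ∘ fstF) cF))
    (fun _ => [true]) (fun _ => [])

/-- `innerPiece ∈ FP`. [cite: AroraBarak2009, §1.3] -/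
theorem innerPiece_mem_FP : innerPiece ∈ FP :=
  iteFn_mem_FP (comp_mem_FP ltFn_mem_FP (fanoutFn_mem_FP
      (comp_mem_FP nthItemFn_mem_FP (fanoutFn_mem_FP sndF_mem_FP cF_mem_FP))
      (comp_mem_FP nthItemFn_mem_FP (fanoutFn_mem_FP (comp_mem_FP sndF_mem_FP fstF_mem_FP) cF_mem_FP))))
    (const_mem_FP _) (const_mem_FP _)

/-- Value of the inner piece. [folklore] -/
theorem innerPiece_rec (U : List Bool) (Cl : List (List Bool)) (I : List Bool) (v w : ℕ) :
    innerPiece (boolPair (boolPair (boolPair (boolPair U (encList Cl)) I) (ones v)) (ones w)) =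
      if bitsToNat (Cl.getD w []) < bitsToNat (Cl.getD v []) then [true] else [] := by
  rw [innerPiece, iteFn_of_oneBit (oneBit_ltFn.comp _)]
  simp [cF, nthItemFn_ones_encList]

/-- The inner piece is at most one symbol. [folklore] -/
theorem length_innerPiece_le (z : List Bool) : (innerPiece z).length ≤ 1 := by
  rw [innerPiece, iteFn_of_oneBit (oneBit_ltFn.comp _)]
  split_ifs <;> simp

/-- **The rank brick** on `x = ⟨⟨z, 1ⁱ⟩, 1ᵛ⟩`: the concatenation fold of the inner pieces over
`w < k` — `1^{rank v}`. [cite: AroraBarak2009, §1.3 (bounded loops)] -/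
noncomputable def rankUF : List Bool → List Bool :=
  foldCat X X innerPiece ∘ fanoutFn id (fstF ∘ fstF ∘ fstF)

/-- `rankUF ∈ FP`. [cite: AroraBarak2009, §1.3 (bounded loops)] -/
theorem rankUF_mem_FP : rankUF ∈ FP :=
  comp_mem_FP (foldCat_mem_FP X X innerPiece_mem_FP)
    (fanoutFn_mem_FP OracleCompose.id_mem_FP (comp_mem_FP fstF_mem_FP (comp_mem_FP fstF_mem_FP fstF_mem_FP)))

/-- Value of the rank brick (as a count over `range k`). [folklore] -/
theorem rankUF_rec (k : ℕ) (Cl : List (List Bool)) (I : List Bool) (v : ℕ) :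
    rankUF (boolPair (boolPair (boolPair (ones k) (encList Cl)) I) (ones v)) =
      ones ((Finset.range k).filter fun w => bitsToNat (Cl.getD w []) < bitsToNat (Cl.getD v [])).card := by
  rw [rankUF, Function.comp_apply, fanoutFn_apply, id, Function.comp_apply, Function.comp_apply,
    fstF_boolPair, fstF_boolPair, fstF_boolPair, foldCat_apply]
  · rw [List.length_replicate, ← ccat_indicator]
    exact ccat_congr fun w _ => innerPiece_rec (ones k) Cl I v w
  · simp [length_boolPair]; omega
  · intro t _
    refine (length_innerPiece_le _).trans ?_
    simp [length_boolPair]; omega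

/-! ### The selection brick: records `⟨z, 1ⁱ⟩`, pieces on `x = ⟨⟨z, 1ⁱ⟩, 1ᵛ⟩` -/

/-- **The middle piece**: `1ᵛ` if the rank of `v` is `i`, else `ε`. [folklore] -/
noncomputable def midPiece : List Bool → List Bool :=
  iteFn (eqPairFn ∘ fanoutFn rankUF (sndF ∘ fstF)) sndF fun _ => []

/-- `midPiece ∈ FP`. [cite: AroraBarak2009, §1.3] -/
theorem midPiece_mem_FP : midPiece ∈ FP :=
  iteFn_mem_FP (comp_mem_FP eqPairFn_mem_FP (fanoutFn_mem_FP rankUF_mem_FP (comp_mem_FP sndF_mem_FP fstF_mem_FP)))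
    sndF_mem_FP (const_mem_FP _)

/-- Value of the middle piece. [folklore] -/
theorem midPiece_rec (k : ℕ) (Cl : List (List Bool)) (i v : ℕ) :
    midPiece (boolPair (boolPair (boolPair (ones k) (encList Cl)) (ones i)) (ones v)) =
      if ((Finset.range k).filter fun w => bitsToNat (Cl.getD w []) < bitsToNat (Cl.getD v [])).card = i
      then ones v else [] := by
  rw [midPiece, iteFn_of_oneBit (GraphSwap.oneBit_eqPairFn_comp _)]
  simp only [Function.comp_apply, fanoutFn_apply, rankUF_rec, sndF_boolPair, fstF_boolPair, eqPairFn_boolPair,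
    GraphSwap.ones_inj, List.cons.injEq, and_true, decide_eq_true_eq]

/-- The middle piece is at most `v` symbols. [folklore] -/
theorem length_midPiece_rec_le (k : ℕ) (Cl : List (List Bool)) (i v : ℕ) :
    (midPiece (boolPair (boolPair (boolPair (ones k) (encList Cl)) (ones i)) (ones v))).length ≤ v := by
  rw [midPiece_rec]; split_ifs <;> simp

/-- **The selection brick** on `⟨z, 1ⁱ⟩`: the concatenation of the middle pieces over `v < k` — the
unary numeral of the vertex of rank `i` (when there is exactly one). [cite: AroraBarak2009, §1.3 (bounded loops)] -/
noncomputable def selectF : List Bool → List Bool :=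
  foldCat X X midPiece ∘ fanoutFn id (fstF ∘ fstF)

/-- `selectF ∈ FP`. [cite: AroraBarak2009, §1.3 (bounded loops)] -/
theorem selectF_mem_FP : selectF ∈ FP :=
  comp_mem_FP (foldCat_mem_FP X X midPiece_mem_FP)
    (fanoutFn_mem_FP OracleCompose.id_mem_FP (comp_mem_FP fstF_mem_FP fstF_mem_FP))

/-- Value of the selection brick: the concatenation of the middle pieces. [folklore] -/
theorem selectF_rec (k : ℕ) (Cl : List (List Bool)) (i : ℕ) :
    selectF (boolPair (boolPair (ones k) (encList Cl)) (ones i)) =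
      ccat (fun v => if ((Finset.range k).filter fun w => bitsToNat (Cl.getD w []) < bitsToNat (Cl.getD v [])).card = i
        then ones v else []) k := by
  rw [selectF, Function.comp_apply, fanoutFn_apply, id, Function.comp_apply, fstF_boolPair, fstF_boolPair,
    foldCat_apply]
  · rw [List.length_replicate]
    exact ccat_congr fun v _ => midPiece_rec k Cl i v
  · simp [length_boolPair]; omega
  · intro t ht
    refine (length_midPiece_rec_le k Cl i t).trans ?_
    simp [length_boolPair] at ht ⊢; omega

/-- A concatenation with exactly one nonempty piece is that piece. [folklore] -/
theorem ccat_single {g : ℕ → List Bool} {n v₀ : ℕ} (hv₀ : v₀ < n) (h : ∀ v, v < n → v ≠ v₀ → g v = []) :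
    ccat g n = g v₀ := by
  induction n with
  | zero => exact absurd hv₀ (Nat.not_lt_zero _)
  | succ n ih =>
    rw [ccat_succ]
    rcases Nat.lt_or_ge v₀ n with hlt | hge
    · rw [ih hlt fun v hv hne => h v (by omega) hne, h n (by omega) (by omega), List.append_nil]
    · obtain rfl : v₀ = n := by omega
      rw [Brick.ccat_eq_ccat_of_eq_nil (Nat.zero_le _) fun v _ hv => h v (by omega) (by omega)]
      simp [ccat]

/-- **On an injective colouring the selection brick returns the sorted vertex**:
`selectF ⟨⟨1ᵏ, colourListCode ρ⟩, 1ⁱ⟩ = 1^{sort ρ i}`. [cite: MckayPiperno2014, §2.2] -/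
theorem selectF_apply {ρ : Fin k → ℕ} (hρ : Function.Injective ρ) (i : Fin k) :
    selectF (boolPair (boolPair (ones k) (colourListCode ρ)) (ones i)) = ones (Tuple.sort ρ i : ℕ) := by
  rw [colourListCode, selectF_rec]
  have hrank : ∀ v : Fin k, ((Finset.range k).filter fun w =>
      bitsToNat ((List.ofFn fun v : Fin k => encodeNat (ρ v)).getD w []) <
        bitsToNat ((List.ofFn fun v : Fin k => encodeNat (ρ v)).getD v [])).card = rankOf ρ v := by
    intro v
    rw [← card_filter_range_eq_rankOf]
    refine congrArg Finset.card (Finset.filter_congr fun w hw => ?_)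
    rw [Finset.mem_range] at hw
    rw [getD_colourList ρ hw, getD_colourList ρ v.is_lt, bitsToNat_encodeNat, bitsToNat_encodeNat]
    simp [hw]
  rw [ccat_single (Tuple.sort ρ i).is_lt]
  · rw [if_pos ((hrank (Tuple.sort ρ i)).trans (rankOf_sort hρ i))]
  · intro v hv hne
    have h := hrank ⟨v, hv⟩
    rw [h, if_neg]
    intro heq
    exact hne (congrArg Fin.val (eq_sort_of_rankOf_eq hρ heq))

/-! ### The brick -/

/-- **The outer piece** on `⟨z, 1ⁱ⟩`: the frame `⟨selectF ⟨z, 1ⁱ⟩, ε⟩`. [folklore] -/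
noncomputable def outPiece : List Bool → List Bool := fanoutFn selectF fun _ => []

/-- `outPiece ∈ FP`. [folklore] -/
theorem outPiece_mem_FP : outPiece ∈ FP := fanoutFn_mem_FP selectF_mem_FP (const_mem_FP _)

/-- Value of the outer piece on an injective colouring. [folklore] -/
theorem outPiece_apply {ρ : Fin k → ℕ} (hρ : Function.Injective ρ) (i : Fin k) :
    outPiece (boolPair (boolPair (ones k) (colourListCode ρ)) (ones i)) = boolPair (ones (Tuple.sort ρ i : ℕ)) [] := by
  rw [outPiece, fanoutFn_apply, selectF_apply hρ i]

/-- **The sort-permutation brick**: the concatenation fold of the outer pieces over `i < k`.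
[cite: AroraBarak2009, §1.3 (bounded loops)] -/
noncomputable def sortPermFn : List Bool → List Bool :=
  foldCat (Polynomial.C 2 * X + Polynomial.C 2) X outPiece ∘ fanoutFn id fstF

/-- **`sortPermFn ∈ FP`.** [cite: AroraBarak2009, §1.3 (bounded loops)] -/
theorem sortPermFn_mem_FP : sortPermFn ∈ FP :=
  comp_mem_FP (foldCat_mem_FP _ X outPiece_mem_FP) (fanoutFn_mem_FP OracleCompose.id_mem_FP fstF_mem_FP)

/-- **Semantics of the sort-permutation brick**: on `⟨1ᵏ, colourListCode ρ⟩` for an INJECTIVE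
colouring `ρ` it returns the code of the sorting permutation, `permCode (Tuple.sort ρ)`.
[cite: MckayPiperno2014, §2.2 ("a discrete colouring is a permutation")] -/
theorem sortPermFn_apply {ρ : Fin k → ℕ} (hρ : Function.Injective ρ) :
    sortPermFn (boolPair (ones k) (colourListCode ρ)) = permCode (Tuple.sort ρ) := by
  rw [sortPermFn, Function.comp_apply, fanoutFn_apply, id, fstF_boolPair, foldCat_apply]
  · rw [List.length_replicate, permCode,
      ofFn_eq_map_range (fun i : Fin k => ones (Tuple.sort ρ i : ℕ))
        (fun t => if h : t < k then ones (Tuple.sort ρ ⟨t, h⟩ : ℕ) else []) (fun t ht => by rw [dif_pos ht]),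
      ← Brick.ccat_frame_eq_encList]
    refine ccat_congr fun t ht => ?_
    rw [dif_pos ht]
    exact outPiece_apply hρ ⟨t, ht⟩
  · simp [length_boolPair]; omega
  · intro t ht
    rw [List.length_replicate] at ht
    rw [outPiece_apply hρ ⟨t, ht⟩, length_boolPair, List.length_replicate, List.length_nil]
    have := (Tuple.sort ρ ⟨t, ht⟩).is_lt
    simp [length_boolPair]
    omega

end SortPerm

end Literature.Computability.Complexity
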